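import Literature.AlgebraicGeometry.Frobenioids.FinSubextCatAut
import Literature.AlgebraicGeometry.Frobenioids.Categories
import HarnessLib

/-!
# Frobenioids I, §6: `D = B(G)⁰` is slim iff `Z = {1}` — PROOF (Theorem 6.2 (iv) / Theorem 6.4 (i))

Mochizuki, *The geometry of Frobenioids I*, kurims p. 111 (Thm. 6.2 (iv): "Let `Z ⊆ G` be the subgroup of
elements that commute with some open subgroup of `G`. Then `D` is slim if and only if `Z = {1}`"), proof
p. 112 ("since `Z` is the union of subgroups of `G` of the form `Z_G(H)`, it follows formally …"), p. 114
(Thm. 6.4 (i): "`D` is slim if and only if the subgroup of elements of `G` that commute with some open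
subgroup of `G` is trivial"). [cite: MochizukiFrdI2008, Thm. 6.2 (iv) p.111]

PROOF-ONLY companion (abc-iut-L6-t10, D-ζ-c) over abc-iut-L1-t3's `FinSubextCat` / `commOpenSubgroup` and
the tree's `IsSlim` (`Categories.lean`). PROVED, sorry-free: the inverse construction
`centralizerOfAutForget : Aut(D_A → D) → Z_G(Gal(K/A.L))` (Krull topology, normal closures,
`InfiniteGalois.fixedField_fixingSubgroup`), injectivity of both constructions, and
`FinSubextCat.isSlim_iff : IsSlim (FinSubextCat F K) ↔ commOpenSubgroup F K = {1}` — the second assertion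
of Thm. 6.2 (iv) and the slimness clause of Thm. 6.4 (i) EXACTLY as typed in `Thm62iv` / `Thm64i_base`.
-/

noncomputable section

namespace Literature.AlgebraicGeometry.Frobenioids

open CategoryTheory IntermediateField

universe u

namespace FinSubextCat

variable {F : Type u} [Field F] {K : Type u} [Field K] [Algebra F K]

section Galois

variable (A : FinSubextCat F K) [IsGalois F K]

/-! ### From an automorphism of `D_A → D` to `z ∈ Z_G(Gal(K/A.L))` (FrdI p. 112) -/

/-- `A.L(x)`: a finite subextension containing `A.L` and `x`. [cite: MochizukiFrdI2008, Thm. 6.2 (iv) p.112] -/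
def adjoinOver (x : K) : IntermediateField F K := A.L ⊔ F⟮x⟯

/-- `A.L(x)` is a finite extension (`x` is algebraic over `F`). [cite: MochizukiFrdI2008, Thm. 6.2 (iv) p.112] -/
instance finiteDimensional_adjoinOver (x : K) : FiniteDimensional F (adjoinOver A x) := by
  haveI : FiniteDimensional F F⟮x⟯ :=
    IntermediateField.adjoin.finiteDimensional (Algebra.IsSeparable.isSeparable F x).isIntegral
  unfold adjoinOver
  infer_instance

omit [IsGalois F K] in
/-- `A.L ≤ A.L(x)`. [cite: MochizukiFrdI2008, Thm. 6.2 (iv) p.112] -/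
theorem le_adjoinOver (x : K) : A.L ≤ adjoinOver A x := le_sup_left

omit [IsGalois F K] in
/-- `x ∈ A.L(x)`. [cite: MochizukiFrdI2008, Thm. 6.2 (iv) p.112] -/
theorem mem_adjoinOver (x : K) : x ∈ adjoinOver A x :=
  (le_sup_right : F⟮x⟯ ≤ adjoinOver A x) (IntermediateField.mem_adjoin_simple_self F x)

variable {A} in
/-- If the automorphism of `D_A → D` attached to `z ∈ Z_G(Gal(K/A.L))` is trivial, then `z = 1`
(injectivity of `Z_G(H) → Aut(D_{Spec(L)} → D)`: test on the objects `Spec A.L(x) → Spec A.L`).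
[cite: MochizukiFrdI2008, Thm. 6.2 (iv) p.112] -/
theorem eq_one_of_autForgetOfCentralizer_eq_refl {z : K ≃ₐ[F] K}
    (hz : ∀ h ∈ A.L.fixingSubgroup, z * h = h * z)
    (htriv : autForgetOfCentralizer hz = Iso.refl _) : z = 1 := by
  ext x
  have hconj : overConj A z (overIncl A (adjoinOver A x) (le_adjoinOver A x)) = z := by
    rw [overConj_eq hz _ (g := 1) (fun a => rfl)]
    simp
  have happ := congrArg (fun β : Over.forget A ≅ Over.forget A =>
    ((β.hom.app (overIncl A (adjoinOver A x) (le_adjoinOver A x))).toAlgHom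
      ⟨x, mem_adjoinOver A x⟩ : K)) htriv
  simp only [autForgetOfCentralizer_app_apply, hconj] at happ
  rw [happ]
  rfl

/-- The function `K → K` attached to an automorphism `α` of `D_A → D`: on `x` it is the component of
`α` at `(Spec A.L(x) → Spec A.L)`. [cite: MochizukiFrdI2008, Thm. 6.2 (iv) p.112] -/
def centralizerFun (α : Over.forget A ≅ Over.forget A) (x : K) : K :=
  (inclApp A α (adjoinOver A x) (le_adjoinOver A x) ⟨x, mem_adjoinOver A x⟩ : K)

/-- The function attached to `α` agrees with the component of `α` at every `(Spec L' → Spec A.L)` with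
`x ∈ L'` (compatibility along inclusions). [cite: MochizukiFrdI2008, Thm. 6.2 (iv) p.112] -/
theorem centralizerFun_eq (α : Over.forget A ≅ Over.forget A) {L' : IntermediateField F K}
    [FiniteDimensional F L'] (h : A.L ≤ L') {x : K} (hx : x ∈ L') :
    centralizerFun A α x = (inclApp A α L' h ⟨x, hx⟩ : K) := by
  have h1 : adjoinOver A x ≤ adjoinOver A x ⊔ L' := le_sup_left
  have h2 : L' ≤ adjoinOver A x ⊔ L' := le_sup_right
  rw [centralizerFun, ← inclApp_compat A α (le_adjoinOver A x) h1, ← inclApp_compat A α h h2]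
  rfl

/-- The function attached to `α` is an `F`-algebra endomorphism of `K`. [cite: MochizukiFrdI2008, Thm. 6.2 (iv) p.112] -/
def centralizerHom (α : Over.forget A ≅ Over.forget A) : K →ₐ[F] K where
  toFun := centralizerFun A α
  map_one' := by
    rw [centralizerFun_eq A α le_rfl (one_mem A.L)]
    exact congrArg Subtype.val (map_one (inclApp A α A.L le_rfl))
  map_mul' x y := by
    have hx : x ∈ adjoinOver A x ⊔ adjoinOver A y :=
      (le_sup_left : adjoinOver A x ≤ adjoinOver A x ⊔ adjoinOver A y) (mem_adjoinOver A x)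
    have hy : y ∈ adjoinOver A x ⊔ adjoinOver A y :=
      (le_sup_right : adjoinOver A y ≤ adjoinOver A x ⊔ adjoinOver A y) (mem_adjoinOver A y)
    have h : A.L ≤ adjoinOver A x ⊔ adjoinOver A y := (le_adjoinOver A x).trans le_sup_left
    rw [centralizerFun_eq A α h (mul_mem hx hy), centralizerFun_eq A α h hx,
      centralizerFun_eq A α h hy]
    exact congrArg Subtype.val
      (map_mul (inclApp A α _ h) ⟨x, hx⟩ ⟨y, hy⟩)
  map_zero' := by
    rw [centralizerFun_eq A α le_rfl (zero_mem A.L)]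
    exact congrArg Subtype.val (map_zero (inclApp A α A.L le_rfl))
  map_add' x y := by
    have hx : x ∈ adjoinOver A x ⊔ adjoinOver A y :=
      (le_sup_left : adjoinOver A x ≤ adjoinOver A x ⊔ adjoinOver A y) (mem_adjoinOver A x)
    have hy : y ∈ adjoinOver A x ⊔ adjoinOver A y :=
      (le_sup_right : adjoinOver A y ≤ adjoinOver A x ⊔ adjoinOver A y) (mem_adjoinOver A y)
    have h : A.L ≤ adjoinOver A x ⊔ adjoinOver A y := (le_adjoinOver A x).trans le_sup_left
    rw [centralizerFun_eq A α h (add_mem hx hy), centralizerFun_eq A α h hx,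
      centralizerFun_eq A α h hy]
    exact congrArg Subtype.val
      (map_add (inclApp A α _ h) ⟨x, hx⟩ ⟨y, hy⟩)
  commutes' r := by
    rw [centralizerFun_eq A α le_rfl (IntermediateField.algebraMap_mem A.L r)]
    exact congrArg Subtype.val ((inclApp A α A.L le_rfl).commutes r)

/-- The element `z ∈ G` attached to an automorphism of `D_A → D` — the map
`Aut(D_{Spec(L)} → D) → Z_G(H)` of FrdI p. 112. [cite: MochizukiFrdI2008, Thm. 6.2 (iv) p.112] -/
def centralizerOfAutForget (α : Over.forget A ≅ Over.forget A) : K ≃ₐ[F] K :=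
  AlgEquiv.ofBijective (centralizerHom A α) (Algebra.IsAlgebraic.algHom_bijective _)

/-- The element of `G` attached to `α` restricts on every finite `L' ⊇ A.L` to the component of `α` at
`(Spec L' → Spec A.L)`. [cite: MochizukiFrdI2008, Thm. 6.2 (iv) p.112] -/
theorem centralizerOfAutForget_apply (α : Over.forget A ≅ Over.forget A) {L' : IntermediateField F K}
    [FiniteDimensional F L'] (h : A.L ≤ L') {x : K} (hx : x ∈ L') :
    centralizerOfAutForget A α x = (inclApp A α L' h ⟨x, hx⟩ : K) :=
  centralizerFun_eq A α h hx

/-- The element of `G` attached to an automorphism of `D_A → D` centralizes `Gal(K/A.L)` (naturality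
along the Galois action on a normal finite subextension). [cite: MochizukiFrdI2008, Thm. 6.2 (iv) p.112] -/
theorem centralizerOfAutForget_centralizes (α : Over.forget A ≅ Over.forget A) :
    ∀ h ∈ A.L.fixingSubgroup, centralizerOfAutForget A α * h = h * centralizerOfAutForget A α := by
  intro h hh
  ext x
  rw [AlgEquiv.mul_apply, AlgEquiv.mul_apply]
  let E : IntermediateField F K := normalClosure F (adjoinOver A x) K
  haveI : FiniteDimensional F E := normalClosure.is_finiteDimensional F (adjoinOver A x) K
  haveI : Normal F E := normalClosure.normal F (adjoinOver A x) K
  have hAE : A.L ≤ E := (le_adjoinOver A x).trans (IntermediateField.le_normalClosure _)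
  have hxE : x ∈ E := IntermediateField.le_normalClosure _ (mem_adjoinOver A x)
  let τ : E →ₐ[F] E := (h.restrictNormal E : E ≃ₐ[F] E)
  have hτ : ∀ w : E, (τ w : K) = h w := fun w => AlgEquiv.restrictNormal_commutes h E w
  have hw : ∀ a : A.L, (τ.comp (IntermediateField.inclusion hAE)) a = IntermediateField.inclusion hAE a :=
    fun a => Subtype.ext (by
      rw [AlgHom.comp_apply, hτ]
      exact (IntermediateField.mem_fixingSubgroup_iff A.L h).mp hh a a.2)
  let φ : overIncl A E hAE ⟶ overIncl A E hAE := Over.homMk ⟨τ⟩ (hom_ext (AlgHom.ext hw))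
  have nat := α.hom.naturality φ
  have key : (τ (inclApp A α E hAE ⟨x, hxE⟩) : K) = (inclApp A α E hAE (τ ⟨x, hxE⟩) : K) :=
    congrArg (fun f : ((⟨E⟩ : FinSubextCat F K) ⟶ ⟨E⟩) => (f.toAlgHom ⟨x, hxE⟩ : K)) nat
  rw [hτ] at key
  have hx' : h x = (τ ⟨x, hxE⟩ : K) := (hτ ⟨x, hxE⟩).symm
  rw [centralizerOfAutForget_apply A α hAE hxE, key, hx',
    centralizerOfAutForget_apply A α hAE (τ ⟨x, hxE⟩).2]

/-- If every "inclusion" component of `α` is the identity, then every component is (transport along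
`g_B`). [cite: MochizukiFrdI2008, Thm. 6.2 (iv) p.112] -/
theorem objApp_eq_id_of_inclApp (α : Over.forget A ≅ Over.forget A)
    (hα : ∀ (L' : IntermediateField F K) [FiniteDimensional F L'] (h : A.L ≤ L') (y : L'),
      (inclApp A α L' h y : K) = y)
    (B : Over A) : objApp A α B = AlgHom.id F B.left.L := by
  let g : K ≃ₐ[F] K := overLift A B
  let L₀ : IntermediateField F K := B.left.L.map (g.symm : K →ₐ[F] K)
  have hL : A.L ≤ L₀ := le_map_overLift_symm B
  have hγ : ∀ y ∈ L₀, (g : K →ₐ[F] K) y ∈ B.left.L := fun y hy => by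
    obtain ⟨w, hw, rfl⟩ := (IntermediateField.mem_map _).mp hy
    rw [AlgEquiv.coe_toAlgHom, AlgEquiv.coe_toAlgHom, AlgEquiv.apply_symm_apply]
    exact hw
  let γ : L₀ →ₐ[F] B.left.L := restrictAlgHom (g : K →ₐ[F] K) L₀ B.left.L hγ
  have hγv : ∀ v : L₀, (γ v : K) = g v := fun v => rfl
  have hγw : ∀ a : A.L, (γ.comp (IntermediateField.inclusion hL)) a = B.hom.toAlgHom a :=
    fun a => Subtype.ext (by
      rw [AlgHom.comp_apply, hγv]
      exact overLift_apply A B a)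
  let φ : B ⟶ overIncl A L₀ hL := Over.homMk ⟨γ⟩ (hom_ext (AlgHom.ext hγw))
  have nat := α.hom.naturality φ
  refine AlgHom.ext fun w => Subtype.ext ?_
  have hy : g.symm w ∈ L₀ := (IntermediateField.mem_map _).mpr ⟨w, w.2, rfl⟩
  have hw : γ ⟨g.symm w, hy⟩ = w := Subtype.ext (g.apply_symm_apply w)
  have key : (γ (inclApp A α L₀ hL ⟨g.symm w, hy⟩) : K) = (objApp A α B (γ ⟨g.symm w, hy⟩) : K) :=
    congrArg (fun f : B.left ⟶ (⟨L₀⟩ : FinSubextCat F K) => (f.toAlgHom ⟨g.symm (w : K), hy⟩ : K)) nat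
  rw [hw, hγv, hα] at key
  -- key : g (g.symm w) = (objApp A α B w : K)
  simp only [AlgEquiv.apply_symm_apply] at key
  rw [← key]
  rfl

/-- If the element of `G` attached to an automorphism `α` of `D_A → D` is trivial, then `α` is
trivial (injectivity of `Aut(D_{Spec(L)} → D) → Z_G(H)`). [cite: MochizukiFrdI2008, Thm. 6.2 (iv) p.112] -/
theorem eq_refl_of_centralizerOfAutForget_eq_one (α : Over.forget A ≅ Over.forget A)
    (hz : centralizerOfAutForget A α = 1) : α = Iso.refl _ := by
  have hα : ∀ (L' : IntermediateField F K) [FiniteDimensional F L'] (h : A.L ≤ L') (y : L'),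
      (inclApp A α L' h y : K) = y := by
    intro L' _ h y
    have key := centralizerOfAutForget_apply A α h y.2
    rw [hz, AlgEquiv.one_apply, Subtype.coe_eta] at key
    exact key.symm
  exact Iso.ext (NatTrans.ext (funext fun B => hom_ext (objApp_eq_id_of_inclApp A α hα B)))

/-- The element of `G` attached to an automorphism of `D_A → D` lies in `Z` (it centralizes the open
subgroup `Gal(K/A.L)`). [cite: MochizukiFrdI2008, Thm. 6.2 (iv) p.112] -/
theorem centralizerOfAutForget_mem (α : Over.forget A ≅ Over.forget A) :
    centralizerOfAutForget A α ∈ commOpenSubgroup F K :=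
  ⟨A.L.fixingSubgroup, A.L.fixingSubgroup_isOpen, centralizerOfAutForget_centralizes A α⟩

/-! ### Theorem 6.2 (iv) / 6.4 (i): `D` is slim iff `Z = {1}` -/

/-- `D` slim ⟹ `Z = {1}` (FrdI Thm. 6.2 (iv) p. 111, proof p. 112: "since `Z` is the union of subgroups
of `G` of the form `Z_G(H)`"). [cite: MochizukiFrdI2008, Thm. 6.2 (iv) p.111] -/
theorem commOpenSubgroup_eq_of_isSlim (hS : IsSlim (FinSubextCat F K)) :
    commOpenSubgroup F K = {1} := by
  ext z
  simp only [Set.mem_singleton_iff]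
  constructor
  · rintro ⟨H, hHo, hz⟩
    obtain ⟨E, hEfin, hEH⟩ :=
      (krullTopology_mem_nhds_one_iff F K (H : Set (K ≃ₐ[F] K))).mp (hHo.mem_nhds H.one_mem)
    haveI := hEfin
    let A : FinSubextCat F K := ⟨E⟩
    have hz' : ∀ h ∈ A.L.fixingSubgroup, z * h = h * z := fun h hh => hz h (hEH hh)
    exact eq_one_of_autForgetOfCentralizer_eq_refl hz' (hS.isRigid_forget A (autForgetOfCentralizer hz'))
  · rintro rfl
    exact ⟨⊤, by simp, fun h _ => by rw [one_mul, mul_one]⟩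

/-- `Z = {1}` ⟹ `D` slim (FrdI Thm. 6.2 (iv) p. 111). [cite: MochizukiFrdI2008, Thm. 6.2 (iv) p.111] -/
theorem isSlim_of_commOpenSubgroup_eq (hZ : commOpenSubgroup F K = {1}) :
    IsSlim (FinSubextCat F K) := by
  refine ⟨fun A α => ?_⟩
  have hz := centralizerOfAutForget_mem A α
  rw [hZ, Set.mem_singleton_iff] at hz
  exact eq_refl_of_centralizerOfAutForget_eq_one A α hz

variable (F K) in
/-- **Theorem 6.2 (iv) / Theorem 6.4 (i)**, slimness criterion — PROVED: for a Galois extension `K/F`,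
`D = B(Gal(K/F))⁰` (as `FinSubextCat F K`) "is slim if and only if `Z = {1}`", `Z ⊆ G` the elements
commuting with some open subgroup (FrdI p. 111; p. 114). [cite: MochizukiFrdI2008, Thm. 6.2 (iv) p.111] -/
theorem isSlim_iff : IsSlim (FinSubextCat F K) ↔ commOpenSubgroup F K = {1} :=
  ⟨commOpenSubgroup_eq_of_isSlim, isSlim_of_commOpenSubgroup_eq⟩

end Galois

end FinSubextCat

end Literature.AlgebraicGeometry.Frobenioids

end
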